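import Mathlib
import HarnessLib
import Summits.Ventures.LatticeQCDFlow.Scoring.BlockMartingaleSqIncrements
import Summits.Ventures.LatticeQCDFlow.Scoring.BlockMartingaleSqFutureDecorrelation

/-!
# The MEAN of the quartic variation of the squared block martingale, from any start, under a
# geometric envelope: `|E_{μ₀}[Σ_{i<b} η_{s,i}²] − 2 (πq)² b²| ≤ K b √b`

HONEST FRAMING: exact (Metropolis-corrected) sampling algorithms for lattice gauge theory;
figures of merit are autocorrelation/cost numbers at stated couplings and volumes; no
continuum-physics claim.

Venture `LatticeQCDFlow` (cell pub-lqcd), topic `Scoring`; FANOUT row 4 (`s0-u1-b`, GEN-30).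
NEW WORK of the cell, not a published result; no definition is introduced; nothing is cited as a
fact.  Notation of `Scoring/BlockMartingaleSqIncrements.lean` (`P_{μ₀}` from ANY initial law,
`|h| ≤ C_h` measurable, `D_t`, `M_{s,i}`, `q = kop κ (h²) − (kop κ h)²`,
`η_{s,i} = 2 M_{s,i} D_{s+i} + (D_{s+i}² − q(X_{s+i}))`) and the geometric sup-norm ENVELOPE of
row 8 (`|(kop κ)^[t] g − πg| ≤ 2 C_g A ρ^t`, `0 ≤ A`, `0 ≤ ρ < 1` — implied by every Doeblin power,
`Scoring/DoeblinPowerGeometricEnvelope.lean`).  The quadratic variation of the array behind the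
batch-means CLT is `(1/(a b²)) Σ_j Σ_{i<b} η_{bj,i}²`; this file computes its MEAN blockwise:
`E_{μ₀}[η_{s,i}²] = 4 (πq)² i + O(√i + 1)` uniformly in the start and the block position — the
`4 M² D²` term has conditional mean `4 M² q(X)` (`Scoring/ChainMartingaleIncrements.chain_increment_sq`),
`E M_{s,i}² = i πq + O(1)` (`Scoring/GeometricEnvelopeBlockSumMoments`), the squared martingale sees
the centred `q − πq` only through an `O(1)` window
(`Scoring/BlockMartingaleSqFutureDecorrelation`, gap `0`), the cross term is `O(E|M_{s,i}|) = O(√i)`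
and the pure increment term is `O(1)` — and sums: `Σ_{i<b} 4(πq)² i = 2(πq)² b² − 2(πq)² b`.

## Content (envelope `(A, ρ)`; `|h| ≤ C_h` measurable; `P_{μ₀}` from any `μ₀`; `m = ∫ q dπ`)

* `sum_range_four_mul_sq_mul` — `Σ_{i<b} 4 m² i = 2 m² b² − 2 m² b`;
* `chain_abs_blockMartingale_integral_le` — `E_{μ₀}|M_{s,i}| ≤ C_h √i`;
* **`abs_chain_sqIncr_sq_integral_sub_le_of_envelope`** —
  `|E_{μ₀}[η_{s,i}²] − 4 m² i| ≤ K₀ + 40 C_h⁴ √i` with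
  `K₀ = 8 C_h⁴ A/(1−ρ) + 4 (8 C_h⁴ A + 32 C_h⁴ A²/(1−ρ))/(1−ρ) + 25 C_h⁴`;
* **`exists_abs_chain_quarticVariation_integral_sub_le_of_envelope`** — `∃ K ≥ 0`, for every `μ₀`, `s`,
  `b`: `|E_{μ₀}[Σ_{i<b} η_{s,i}²] − 2 m² b²| ≤ K b √b`.

NOT CLAIMED: sharp constants; the fluctuation of the quartic variation (that is the block law of
large numbers, `Scoring/BlockQuarticVariationLLN.lean`); unbounded `h`.
-/

noncomputable section

namespace Summit.Ventures.LatticeQCDFlow.Scoring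

open MeasureTheory ProbabilityTheory Filter Finset Preorder
open scoped ENNReal Topology

variable {Ω : Type*} [MeasurableSpace Ω]

/-- `Σ_{i<b} 4 m² i = 2 m² b² − 2 m² b`. -/
theorem sum_range_four_mul_sq_mul (m : ℝ) : ∀ b : ℕ,
    ∑ i ∈ Finset.range b, 4 * m ^ 2 * (i : ℝ) = 2 * m ^ 2 * (b : ℝ) ^ 2 - 2 * m ^ 2 * b
  | 0 => by simp
  | b + 1 => by
    rw [Finset.sum_range_succ, sum_range_four_mul_sq_mul m b]
    push_cast
    ring

section Envelope

variable {κ : Kernel Ω Ω} [IsMarkovKernel κ] {π : Measure Ω} [IsProbabilityMeasure π] {A ρ : ℝ}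

omit [IsProbabilityMeasure π] in
/-- **`E_{μ₀}|M_{s,i}| ≤ C_h √i`** (Jensen and `E M_{s,i}² ≤ i C_h²`). -/
theorem chain_abs_blockMartingale_integral_le {h : Ω → ℝ} (hh : Measurable h) {Ch : ℝ}
    (hCh : ∀ x, |h x| ≤ Ch) (μ₀ : Measure Ω) [IsProbabilityMeasure μ₀] (s i : ℕ) :
    ∫ x, |(∑ r ∈ Finset.range i, (h (x (s + r + 1)) - kop κ h (x (s + r))))| ∂(Kernel.trajMeasure (X := fun _ : ℕ => Ω) (μ₀)
          (fun n : ℕ => κ.comap (fun h' : (i : ↥(Finset.Iic n)) → Ω => h' ⟨n, Finset.mem_Iic.2 le_rfl⟩)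
            (measurable_pi_apply _))) ≤ Ch * Real.sqrt i := by
  set P := (Kernel.trajMeasure (X := fun _ : ℕ => Ω) (μ₀)
        (fun n : ℕ => κ.comap (fun h' : (i : ↥(Finset.Iic n)) → Ω => h' ⟨n, Finset.mem_Iic.2 le_rfl⟩)
          (measurable_pi_apply _))) with hP
  have hC0 : 0 ≤ Ch := (abs_nonneg _).trans (hCh (Classical.choice
    (nonempty_of_isProbabilityMeasure μ₀)))
  have hMm := blockMartingale_measurable κ hh s i
  have hMb := abs_blockMartingale_le κ hCh s i
  have hM2 := chain_blockMartingale_sq_le κ μ₀ hh hCh s i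
  rw [← hP] at hM2
  have hJ := sq_integral_le_integral_sq P (g := fun x => |(∑ r ∈ Finset.range i, (h (x (s + r + 1)) - kop κ h (x (s + r))))|) hMm.abs
    (C := i * (2 * Ch)) (fun x => by rw [abs_abs]; exact hMb x)
  simp only [sq_abs] at hJ
  have h0 : 0 ≤ ∫ x, |(∑ r ∈ Finset.range i, (h (x (s + r + 1)) - kop κ h (x (s + r))))| ∂P := integral_nonneg fun x => abs_nonneg _
  have h1 : (∫ x, |(∑ r ∈ Finset.range i, (h (x (s + r + 1)) - kop κ h (x (s + r))))| ∂P) ^ 2 ≤ (Ch * Real.sqrt i) ^ 2 := by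
    rw [mul_pow, Real.sq_sqrt (Nat.cast_nonneg _)]
    linarith
  exact (pow_le_pow_iff_left₀ h0 (by positivity) two_ne_zero).1 h1

/-- **THE MEAN OF ONE SQUARED INCREMENT**: `|E_{μ₀}[η_{s,i}²] − 4 m² i| ≤ K₀ + 40 C_h⁴ √i`, with
`m = ∫ q dπ` and `K₀ = 4 C_h² (2 C_h² A/(1−ρ)) + 4 ((8 C_h⁴ A + 32 C_h⁴ A²/(1−ρ)) ρ⁰/(1−ρ)) + 25 C_h⁴`. -/
theorem abs_chain_sqIncr_sq_integral_sub_le_of_envelope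
    (henv : ∀ (g : Ω → ℝ), Measurable g → ∀ (Cg : ℝ), (∀ x, |g x| ≤ Cg) →
      ∀ (t : ℕ) (x : Ω), |(kop κ)^[t] g x - ∫ y, g y ∂π| ≤ 2 * Cg * (A * ρ ^ t))
    (hA : 0 ≤ A) (hρ0 : 0 ≤ ρ) (hρ1 : ρ < 1)
    {h : Ω → ℝ} (hh : Measurable h) {Ch : ℝ} (hCh : ∀ x, |h x| ≤ Ch)
    (μ₀ : Measure Ω) [IsProbabilityMeasure μ₀] (s i : ℕ) :
    |∫ x, (2 * (∑ r ∈ Finset.range i, (h (x (s + r + 1)) - kop κ h (x (s + r)))) * (h (x (s + i + 1)) - kop κ h (x (s + i))) + ((h (x (s + i + 1)) - kop κ h (x (s + i))) ^ 2 - (kop κ (fun y => h y ^ 2) (x (s + i)) - (kop κ h (x (s + i))) ^ 2))) ^ 2 ∂(Kernel.trajMeasure (X := fun _ : ℕ => Ω) (μ₀)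
          (fun n : ℕ => κ.comap (fun h' : (i : ↥(Finset.Iic n)) → Ω => h' ⟨n, Finset.mem_Iic.2 le_rfl⟩)
            (measurable_pi_apply _))) - 4 * (∫ y, (kop κ (fun y => h y ^ 2) y - (kop κ h y) ^ 2) ∂π) ^ 2 * i|
      ≤ (4 * Ch ^ 2 * (2 * Ch ^ 2 * A / (1 - ρ))
          + 4 * ((8 * Ch ^ 2 * Ch ^ 2 * A + 32 * Ch ^ 2 * Ch ^ 2 * A ^ 2 / (1 - ρ)) * ρ ^ 0 / (1 - ρ))
          + 25 * Ch ^ 4)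
        + 40 * Ch ^ 4 * Real.sqrt i := by
  set P := (Kernel.trajMeasure (X := fun _ : ℕ => Ω) (μ₀)
        (fun n : ℕ => κ.comap (fun h' : (i : ↥(Finset.Iic n)) → Ω => h' ⟨n, Finset.mem_Iic.2 le_rfl⟩)
          (measurable_pi_apply _))) with hP
  set m : ℝ := ∫ y, (kop κ (fun y => h y ^ 2) y - (kop κ h y) ^ 2) ∂π with hm
  have hC0 : 0 ≤ Ch := (abs_nonneg _).trans (hCh (Classical.choice
    (nonempty_of_isProbabilityMeasure μ₀)))
  obtain ⟨hqm, hqb⟩ := kopCondVar_bounded_measurable κ hh hCh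
  have hq0 : ∀ z, 0 ≤ (kop κ (fun y => h y ^ 2) z - (kop κ h z) ^ 2) := kopCondVar_nonneg κ hh hCh
  have hm0 : 0 ≤ m := integral_nonneg hq0
  have hmC : m ≤ Ch ^ 2 := by
    have h1 := norm_integral_le_of_norm_le_const (μ := π) (f := fun y => (kop κ (fun y => h y ^ 2) y - (kop κ h y) ^ 2)) (C := Ch ^ 2)
      (Eventually.of_forall fun y => by rw [Real.norm_eq_abs]; exact hqb y)
    rw [Real.norm_eq_abs, probReal_univ, mul_one] at h1
    exact (le_abs_self _).trans h1
  -- the pieces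
  have hMm := blockMartingale_measurable κ hh s i
  have hMb := abs_blockMartingale_le κ hCh s i
  have hMd := blockMartingale_dependsOn (kop κ) h s i
  have hDm : Measurable fun x : ℕ → Ω => (h (x (s + i + 1)) - kop κ h (x (s + i))) :=
    (hh.comp (measurable_pi_apply _)).sub ((measurable_kop κ hh).comp (measurable_pi_apply _))
  have hDb : ∀ x : ℕ → Ω, |(h (x (s + i + 1)) - kop κ h (x (s + i)))| ≤ 2 * Ch := fun x =>
    (abs_sub _ _).trans (by linarith [hCh (x (s + i + 1)), abs_kop_le κ hCh (x (s + i))])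
  have hEb : ∀ x : ℕ → Ω, |(h (x (s + i + 1)) - kop κ h (x (s + i))) ^ 2 - (kop κ (fun y => h y ^ 2) (x (s + i)) - (kop κ h (x (s + i))) ^ 2)| ≤ 5 * Ch ^ 2 := by
    intro x
    have hD := hDb x; have hq := hqb (x (s + i))
    rw [abs_le] at hD hq ⊢; constructor <;> nlinarith
  have hqXm : Measurable fun x : ℕ → Ω => (kop κ (fun y => h y ^ 2) (x (s + i)) - (kop κ h (x (s + i))) ^ 2) := hqm.comp (measurable_pi_apply _)
  have hEm : Measurable fun x : ℕ → Ω => (h (x (s + i + 1)) - kop κ h (x (s + i))) ^ 2 - (kop κ (fun y => h y ^ 2) (x (s + i)) - (kop κ h (x (s + i))) ^ 2) :=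
    (hDm.pow_const 2).sub hqXm
  -- the centred conditional variance
  have hqcm : Measurable fun z => (kop κ (fun y => h y ^ 2) z - (kop κ h z) ^ 2) - m := hqm.sub_const m
  have hqcb : ∀ z, |(kop κ (fun y => h y ^ 2) z - (kop κ h z) ^ 2) - m| ≤ Ch ^ 2 := fun z => by
    have h1 := hqb z; have h2 := hq0 z
    rw [abs_le] at h1 ⊢; constructor <;> linarith
  have hqc0 : ∫ y, ((kop κ (fun y => h y ^ 2) y - (kop κ h y) ^ 2) - m) ∂π = 0 := by
    rw [integral_sub (integrable_of_bounded π hqm hqb) (integrable_const _), integral_const,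
      probReal_univ, one_smul, hm, sub_self]
  -- (1) `∫ M² D² = ∫ M² q(X_{s+i})`
  have hM2m : Measurable fun x : ℕ → Ω => (∑ r ∈ Finset.range i, (h (x (s + r + 1)) - kop κ h (x (s + r)))) ^ 2 := hMm.pow_const 2
  have hM2d : DependsOn (fun x : ℕ → Ω => (∑ r ∈ Finset.range i, (h (x (s + r + 1)) - kop κ h (x (s + r)))) ^ 2) (Set.Iic (s + i)) := by
    intro x y hxy
    have hM' := hMd hxy
    dsimp only at hM' ⊢
    rw [hM']
  have hM2b : ∀ x : ℕ → Ω, |(∑ r ∈ Finset.range i, (h (x (s + r + 1)) - kop κ h (x (s + r)))) ^ 2| ≤ (i * (2 * Ch)) ^ 2 := fun x => by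
    rw [abs_pow]; exact pow_le_pow_left₀ (abs_nonneg _) (hMb x) 2
  have e1 := chain_increment_sq κ μ₀ (s + i) hM2m hM2d hM2b hh hCh
  rw [← hP] at e1
  -- (2) `|∫ M² − i m| ≤ K₁`
  have e2 := abs_chain_blockMartingale_sq_sub_le_of_envelope henv hA hρ0 hρ1 hh hCh μ₀ s i
  rw [← hP] at e2
  -- (3) `|∫ M² (q(X_{s+i}) − m)| ≤ K₂`
  have e3 := abs_chain_blockMartingale_sq_mul_future_le_of_envelope μ₀ henv hA hρ0 hρ1 hh hCh
    hqcm hqcb hqc0 s i 0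
  rw [← hP, show s + i + 0 = s + i from rfl] at e3
  rw [← hm] at e2
  -- (4) `|∫ M D (D² − q)| ≤ 10 C_h⁴ √i`
  have e4a := chain_abs_blockMartingale_integral_le (κ := κ) hh hCh μ₀ s i
  rw [← hP] at e4a
  -- integrability and bounds of the four integrands
  have hi1 : Integrable (fun x : ℕ → Ω => (∑ r ∈ Finset.range i, (h (x (s + r + 1)) - kop κ h (x (s + r)))) ^ 2 * (h (x (s + i + 1)) - kop κ h (x (s + i))) ^ 2) P :=
    integrable_of_bounded P (hM2m.mul (hDm.pow_const 2)) (C := (i * (2 * Ch)) ^ 2 * (2 * Ch) ^ 2)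
      fun x => by
        rw [abs_mul, abs_pow ((h (x (s + i + 1)) - kop κ h (x (s + i))))]
        exact mul_le_mul (hM2b x) (pow_le_pow_left₀ (abs_nonneg _) (hDb x) 2) (by positivity)
          (by positivity)
  have hi2 : Integrable (fun x : ℕ → Ω => (∑ r ∈ Finset.range i, (h (x (s + r + 1)) - kop κ h (x (s + r)))) * (h (x (s + i + 1)) - kop κ h (x (s + i)))
      * ((h (x (s + i + 1)) - kop κ h (x (s + i))) ^ 2 - (kop κ (fun y => h y ^ 2) (x (s + i)) - (kop κ h (x (s + i))) ^ 2))) P :=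
    integrable_of_bounded P ((hMm.mul hDm).mul hEm) (C := i * (2 * Ch) * (2 * Ch) * (5 * Ch ^ 2))
      fun x => by
        rw [abs_mul, abs_mul]
        exact mul_le_mul (mul_le_mul (hMb x) (hDb x) (abs_nonneg _) (by positivity)) (hEb x)
          (abs_nonneg _) (by positivity)
  have hi3 : Integrable (fun x : ℕ → Ω => ((h (x (s + i + 1)) - kop κ h (x (s + i))) ^ 2 - (kop κ (fun y => h y ^ 2) (x (s + i)) - (kop κ h (x (s + i))) ^ 2)) ^ 2) P :=
    integrable_of_bounded P (hEm.pow_const 2) (C := (5 * Ch ^ 2) ^ 2) fun x => by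
      rw [abs_pow]; exact pow_le_pow_left₀ (abs_nonneg _) (hEb x) 2
  have hi4 : Integrable (fun x : ℕ → Ω => (∑ r ∈ Finset.range i, (h (x (s + r + 1)) - kop κ h (x (s + r)))) ^ 2 * (kop κ (fun y => h y ^ 2) (x (s + i)) - (kop κ h (x (s + i))) ^ 2)) P :=
    integrable_of_bounded P (hM2m.mul hqXm) (C := (i * (2 * Ch)) ^ 2 * Ch ^ 2) fun x => by
      rw [abs_mul]; exact mul_le_mul (hM2b x) (hqb _) (abs_nonneg _) (by positivity)
  have hi5 : Integrable (fun x : ℕ → Ω => (∑ r ∈ Finset.range i, (h (x (s + r + 1)) - kop κ h (x (s + r)))) ^ 2 * ((kop κ (fun y => h y ^ 2) (x (s + i)) - (kop κ h (x (s + i))) ^ 2) - m)) P :=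
    integrable_of_bounded P (hM2m.mul (hqXm.sub_const m)) (C := (i * (2 * Ch)) ^ 2 * Ch ^ 2)
      fun x => by rw [abs_mul]; exact mul_le_mul (hM2b x) (hqcb _) (abs_nonneg _) (by positivity)
  have hi6 : Integrable (fun x : ℕ → Ω => (∑ r ∈ Finset.range i, (h (x (s + r + 1)) - kop κ h (x (s + r)))) ^ 2) P :=
    integrable_of_bounded P hM2m hM2b
  -- the expansion of `η²`
  have hexp : ∀ x : ℕ → Ω, (2 * (∑ r ∈ Finset.range i, (h (x (s + r + 1)) - kop κ h (x (s + r)))) * (h (x (s + i + 1)) - kop κ h (x (s + i))) + ((h (x (s + i + 1)) - kop κ h (x (s + i))) ^ 2 - (kop κ (fun y => h y ^ 2) (x (s + i)) - (kop κ h (x (s + i))) ^ 2))) ^ 2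
      = 4 * ((∑ r ∈ Finset.range i, (h (x (s + r + 1)) - kop κ h (x (s + r)))) ^ 2 * (h (x (s + i + 1)) - kop κ h (x (s + i))) ^ 2)
        + 4 * ((∑ r ∈ Finset.range i, (h (x (s + r + 1)) - kop κ h (x (s + r)))) * (h (x (s + i + 1)) - kop κ h (x (s + i))) * ((h (x (s + i + 1)) - kop κ h (x (s + i))) ^ 2 - (kop κ (fun y => h y ^ 2) (x (s + i)) - (kop κ h (x (s + i))) ^ 2)))
        + ((h (x (s + i + 1)) - kop κ h (x (s + i))) ^ 2 - (kop κ (fun y => h y ^ 2) (x (s + i)) - (kop κ h (x (s + i))) ^ 2)) ^ 2 := fun x => by ring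
  have hI : ∫ x, (2 * (∑ r ∈ Finset.range i, (h (x (s + r + 1)) - kop κ h (x (s + r)))) * (h (x (s + i + 1)) - kop κ h (x (s + i))) + ((h (x (s + i + 1)) - kop κ h (x (s + i))) ^ 2 - (kop κ (fun y => h y ^ 2) (x (s + i)) - (kop κ h (x (s + i))) ^ 2))) ^ 2 ∂P
      = 4 * ∫ x, (∑ r ∈ Finset.range i, (h (x (s + r + 1)) - kop κ h (x (s + r)))) ^ 2 * (h (x (s + i + 1)) - kop κ h (x (s + i))) ^ 2 ∂P
        + 4 * ∫ x, (∑ r ∈ Finset.range i, (h (x (s + r + 1)) - kop κ h (x (s + r)))) * (h (x (s + i + 1)) - kop κ h (x (s + i))) * ((h (x (s + i + 1)) - kop κ h (x (s + i))) ^ 2 - (kop κ (fun y => h y ^ 2) (x (s + i)) - (kop κ h (x (s + i))) ^ 2)) ∂P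
        + ∫ x, ((h (x (s + i + 1)) - kop κ h (x (s + i))) ^ 2 - (kop κ (fun y => h y ^ 2) (x (s + i)) - (kop κ h (x (s + i))) ^ 2)) ^ 2 ∂P := by
    have hi12 : Integrable (fun x : ℕ → Ω => 4 * ((∑ r ∈ Finset.range i, (h (x (s + r + 1)) - kop κ h (x (s + r)))) ^ 2 * (h (x (s + i + 1)) - kop κ h (x (s + i))) ^ 2)
        + 4 * ((∑ r ∈ Finset.range i, (h (x (s + r + 1)) - kop κ h (x (s + r)))) * (h (x (s + i + 1)) - kop κ h (x (s + i))) * ((h (x (s + i + 1)) - kop κ h (x (s + i))) ^ 2 - (kop κ (fun y => h y ^ 2) (x (s + i)) - (kop κ h (x (s + i))) ^ 2)))) P :=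
      (hi1.const_mul 4).add (hi2.const_mul 4)
    rw [integral_congr_ae (ae_of_all _ hexp), integral_add hi12 hi3,
      integral_add (hi1.const_mul 4) (hi2.const_mul 4), integral_const_mul, integral_const_mul]
  -- `∫ M² q(X) = m ∫ M² + ∫ M² (q(X) − m)`
  have hsplit : ∫ x, (∑ r ∈ Finset.range i, (h (x (s + r + 1)) - kop κ h (x (s + r)))) ^ 2 * (kop κ (fun y => h y ^ 2) (x (s + i)) - (kop κ h (x (s + i))) ^ 2) ∂P
      = m * ∫ x, (∑ r ∈ Finset.range i, (h (x (s + r + 1)) - kop κ h (x (s + r)))) ^ 2 ∂P + ∫ x, (∑ r ∈ Finset.range i, (h (x (s + r + 1)) - kop κ h (x (s + r)))) ^ 2 * ((kop κ (fun y => h y ^ 2) (x (s + i)) - (kop κ h (x (s + i))) ^ 2) - m) ∂P := by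
    have he : ∀ x : ℕ → Ω, (∑ r ∈ Finset.range i, (h (x (s + r + 1)) - kop κ h (x (s + r)))) ^ 2 * (kop κ (fun y => h y ^ 2) (x (s + i)) - (kop κ h (x (s + i))) ^ 2)
        = m * (∑ r ∈ Finset.range i, (h (x (s + r + 1)) - kop κ h (x (s + r)))) ^ 2 + (∑ r ∈ Finset.range i, (h (x (s + r + 1)) - kop κ h (x (s + r)))) ^ 2 * ((kop κ (fun y => h y ^ 2) (x (s + i)) - (kop κ h (x (s + i))) ^ 2) - m) := fun x => by ring
    rw [integral_congr_ae (ae_of_all _ he), integral_add (hi6.const_mul m) hi5, integral_const_mul]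
  -- the cross term
  have e4 : |∫ x, (∑ r ∈ Finset.range i, (h (x (s + r + 1)) - kop κ h (x (s + r)))) * (h (x (s + i + 1)) - kop κ h (x (s + i))) * ((h (x (s + i + 1)) - kop κ h (x (s + i))) ^ 2 - (kop κ (fun y => h y ^ 2) (x (s + i)) - (kop κ h (x (s + i))) ^ 2)) ∂P|
      ≤ 10 * Ch ^ 4 * Real.sqrt i := by
    have hb : ∀ x : ℕ → Ω, |(∑ r ∈ Finset.range i, (h (x (s + r + 1)) - kop κ h (x (s + r)))) * (h (x (s + i + 1)) - kop κ h (x (s + i))) * ((h (x (s + i + 1)) - kop κ h (x (s + i))) ^ 2 - (kop κ (fun y => h y ^ 2) (x (s + i)) - (kop κ h (x (s + i))) ^ 2))|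
        ≤ 10 * Ch ^ 3 * |(∑ r ∈ Finset.range i, (h (x (s + r + 1)) - kop κ h (x (s + r))))| := fun x => by
      rw [abs_mul, abs_mul]
      have := mul_le_mul (hDb x) (hEb x) (abs_nonneg _) (by positivity)
      calc |(∑ r ∈ Finset.range i, (h (x (s + r + 1)) - kop κ h (x (s + r))))| * |(h (x (s + i + 1)) - kop κ h (x (s + i)))| * |(h (x (s + i + 1)) - kop κ h (x (s + i))) ^ 2 - (kop κ (fun y => h y ^ 2) (x (s + i)) - (kop κ h (x (s + i))) ^ 2)|
          = |(∑ r ∈ Finset.range i, (h (x (s + r + 1)) - kop κ h (x (s + r))))| * (|(h (x (s + i + 1)) - kop κ h (x (s + i)))| * |(h (x (s + i + 1)) - kop κ h (x (s + i))) ^ 2 - (kop κ (fun y => h y ^ 2) (x (s + i)) - (kop κ h (x (s + i))) ^ 2)|) := by ring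
        _ ≤ |(∑ r ∈ Finset.range i, (h (x (s + r + 1)) - kop κ h (x (s + r))))| * (2 * Ch * (5 * Ch ^ 2)) := mul_le_mul_of_nonneg_left this (abs_nonneg _)
        _ = 10 * Ch ^ 3 * |(∑ r ∈ Finset.range i, (h (x (s + r + 1)) - kop κ h (x (s + r))))| := by ring
    calc |∫ x, (∑ r ∈ Finset.range i, (h (x (s + r + 1)) - kop κ h (x (s + r)))) * (h (x (s + i + 1)) - kop κ h (x (s + i))) * ((h (x (s + i + 1)) - kop κ h (x (s + i))) ^ 2 - (kop κ (fun y => h y ^ 2) (x (s + i)) - (kop κ h (x (s + i))) ^ 2)) ∂P|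
        ≤ ∫ x, |(∑ r ∈ Finset.range i, (h (x (s + r + 1)) - kop κ h (x (s + r)))) * (h (x (s + i + 1)) - kop κ h (x (s + i))) * ((h (x (s + i + 1)) - kop κ h (x (s + i))) ^ 2 - (kop κ (fun y => h y ^ 2) (x (s + i)) - (kop κ h (x (s + i))) ^ 2))| ∂P :=
          abs_integral_le_integral_abs
      _ ≤ ∫ x, 10 * Ch ^ 3 * |(∑ r ∈ Finset.range i, (h (x (s + r + 1)) - kop κ h (x (s + r))))| ∂P :=
          integral_mono_of_nonneg (ae_of_all _ fun x => abs_nonneg _) ((integrable_of_bounded P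
            hMm.abs (C := i * (2 * Ch)) fun x => by rw [abs_abs]; exact hMb x).const_mul _)
            (ae_of_all _ hb)
      _ = 10 * Ch ^ 3 * ∫ x, |(∑ r ∈ Finset.range i, (h (x (s + r + 1)) - kop κ h (x (s + r))))| ∂P := integral_const_mul _ _
      _ ≤ 10 * Ch ^ 3 * (Ch * Real.sqrt i) := mul_le_mul_of_nonneg_left e4a (by positivity)
      _ = 10 * Ch ^ 4 * Real.sqrt i := by ring
  -- the pure increment term
  have e5 : |∫ x, ((h (x (s + i + 1)) - kop κ h (x (s + i))) ^ 2 - (kop κ (fun y => h y ^ 2) (x (s + i)) - (kop κ h (x (s + i))) ^ 2)) ^ 2 ∂P| ≤ 25 * Ch ^ 4 := by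
    have h1 := norm_integral_le_of_norm_le_const (μ := P)
      (f := fun x : ℕ → Ω => ((h (x (s + i + 1)) - kop κ h (x (s + i))) ^ 2 - (kop κ (fun y => h y ^ 2) (x (s + i)) - (kop κ h (x (s + i))) ^ 2)) ^ 2) (C := 25 * Ch ^ 4)
      (Eventually.of_forall fun x => by
        rw [Real.norm_eq_abs, abs_pow]
        calc |(h (x (s + i + 1)) - kop κ h (x (s + i))) ^ 2 - (kop κ (fun y => h y ^ 2) (x (s + i)) - (kop κ h (x (s + i))) ^ 2)| ^ 2 ≤ (5 * Ch ^ 2) ^ 2 :=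
            pow_le_pow_left₀ (abs_nonneg _) (hEb x) 2
          _ = 25 * Ch ^ 4 := by ring)
    rwa [Real.norm_eq_abs, probReal_univ, mul_one] at h1
  -- assemble
  have key : ∫ x, (2 * (∑ r ∈ Finset.range i, (h (x (s + r + 1)) - kop κ h (x (s + r)))) * (h (x (s + i + 1)) - kop κ h (x (s + i))) + ((h (x (s + i + 1)) - kop κ h (x (s + i))) ^ 2 - (kop κ (fun y => h y ^ 2) (x (s + i)) - (kop κ h (x (s + i))) ^ 2))) ^ 2 ∂P - 4 * m ^ 2 * i
      = 4 * m * (∫ x, (∑ r ∈ Finset.range i, (h (x (s + r + 1)) - kop κ h (x (s + r)))) ^ 2 ∂P - i * m)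
        + 4 * ∫ x, (∑ r ∈ Finset.range i, (h (x (s + r + 1)) - kop κ h (x (s + r)))) ^ 2 * ((kop κ (fun y => h y ^ 2) (x (s + i)) - (kop κ h (x (s + i))) ^ 2) - m) ∂P
        + 4 * ∫ x, (∑ r ∈ Finset.range i, (h (x (s + r + 1)) - kop κ h (x (s + r)))) * (h (x (s + i + 1)) - kop κ h (x (s + i))) * ((h (x (s + i + 1)) - kop κ h (x (s + i))) ^ 2 - (kop κ (fun y => h y ^ 2) (x (s + i)) - (kop κ h (x (s + i))) ^ 2)) ∂P
        + ∫ x, ((h (x (s + i + 1)) - kop κ h (x (s + i))) ^ 2 - (kop κ (fun y => h y ^ 2) (x (s + i)) - (kop κ h (x (s + i))) ^ 2)) ^ 2 ∂P := by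
    rw [hI, e1, hsplit]; ring
  rw [key]
  have t1 : |4 * m * (∫ x, (∑ r ∈ Finset.range i, (h (x (s + r + 1)) - kop κ h (x (s + r)))) ^ 2 ∂P - i * m)| ≤ 4 * Ch ^ 2 * (2 * Ch ^ 2 * A / (1 - ρ)) := by
    rw [abs_mul, abs_mul, abs_of_nonneg hm0, show |(4 : ℝ)| = 4 by norm_num]
    exact mul_le_mul (mul_le_mul_of_nonneg_left hmC (by norm_num)) e2 (abs_nonneg _)
      (by positivity)
  have t2 : |4 * ∫ x, (∑ r ∈ Finset.range i, (h (x (s + r + 1)) - kop κ h (x (s + r)))) ^ 2 * ((kop κ (fun y => h y ^ 2) (x (s + i)) - (kop κ h (x (s + i))) ^ 2) - m) ∂P|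
      ≤ 4 * ((8 * Ch ^ 2 * Ch ^ 2 * A + 32 * Ch ^ 2 * Ch ^ 2 * A ^ 2 / (1 - ρ)) * ρ ^ 0 / (1 - ρ)) := by
    rw [abs_mul, show |(4 : ℝ)| = 4 by norm_num]
    exact mul_le_mul_of_nonneg_left e3 (by norm_num)
  have t3 : |4 * ∫ x, (∑ r ∈ Finset.range i, (h (x (s + r + 1)) - kop κ h (x (s + r)))) * (h (x (s + i + 1)) - kop κ h (x (s + i))) * ((h (x (s + i + 1)) - kop κ h (x (s + i))) ^ 2 - (kop κ (fun y => h y ^ 2) (x (s + i)) - (kop κ h (x (s + i))) ^ 2)) ∂P|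
      ≤ 40 * Ch ^ 4 * Real.sqrt i := by
    rw [abs_mul, show |(4 : ℝ)| = 4 by norm_num]; linarith
  calc _ ≤ |4 * m * (∫ x, (∑ r ∈ Finset.range i, (h (x (s + r + 1)) - kop κ h (x (s + r)))) ^ 2 ∂P - i * m)|
        + |4 * ∫ x, (∑ r ∈ Finset.range i, (h (x (s + r + 1)) - kop κ h (x (s + r)))) ^ 2 * ((kop κ (fun y => h y ^ 2) (x (s + i)) - (kop κ h (x (s + i))) ^ 2) - m) ∂P|
        + |4 * ∫ x, (∑ r ∈ Finset.range i, (h (x (s + r + 1)) - kop κ h (x (s + r)))) * (h (x (s + i + 1)) - kop κ h (x (s + i))) * ((h (x (s + i + 1)) - kop κ h (x (s + i))) ^ 2 - (kop κ (fun y => h y ^ 2) (x (s + i)) - (kop κ h (x (s + i))) ^ 2)) ∂P|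
        + |∫ x, ((h (x (s + i + 1)) - kop κ h (x (s + i))) ^ 2 - (kop κ (fun y => h y ^ 2) (x (s + i)) - (kop κ h (x (s + i))) ^ 2)) ^ 2 ∂P| := by
          refine (abs_add_le _ _).trans (add_le_add ((abs_add_le _ _).trans (add_le_add
            ((abs_add_le _ _).trans le_rfl) le_rfl)) le_rfl)
    _ ≤ _ := by linarith

/-- **THE MEAN OF THE QUARTIC VARIATION OF A BLOCK**: there is `K ≥ 0` (depending on `C_h, A, ρ`
only) such that for every initial law `μ₀`, every block position `s` and every block length `b`,
`|E_{μ₀}[Σ_{i<b} η_{s,i}²] − 2 m² b²| ≤ K b √b` (`m = ∫ q dπ`). -/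
theorem exists_abs_chain_quarticVariation_integral_sub_le_of_envelope
    (henv : ∀ (g : Ω → ℝ), Measurable g → ∀ (Cg : ℝ), (∀ x, |g x| ≤ Cg) →
      ∀ (t : ℕ) (x : Ω), |(kop κ)^[t] g x - ∫ y, g y ∂π| ≤ 2 * Cg * (A * ρ ^ t))
    (hA : 0 ≤ A) (hρ0 : 0 ≤ ρ) (hρ1 : ρ < 1)
    {h : Ω → ℝ} (hh : Measurable h) {Ch : ℝ} (hCh : ∀ x, |h x| ≤ Ch) :
    ∃ K : ℝ, 0 ≤ K ∧ ∀ (μ₀ : Measure Ω) [IsProbabilityMeasure μ₀] (s b : ℕ),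
      |∫ x, (∑ i ∈ Finset.range b, (2 * (∑ r ∈ Finset.range i, (h (x (s + r + 1)) - kop κ h (x (s + r)))) * (h (x (s + i + 1)) - kop κ h (x (s + i))) + ((h (x (s + i + 1)) - kop κ h (x (s + i))) ^ 2 - (kop κ (fun y => h y ^ 2) (x (s + i)) - (kop κ h (x (s + i))) ^ 2))) ^ 2) ∂(Kernel.trajMeasure (X := fun _ : ℕ => Ω) (μ₀)
            (fun n : ℕ => κ.comap (fun h' : (i : ↥(Finset.Iic n)) → Ω => h' ⟨n, Finset.mem_Iic.2 le_rfl⟩)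
              (measurable_pi_apply _)))
          - 2 * (∫ y, (kop κ (fun y => h y ^ 2) y - (kop κ h y) ^ 2) ∂π) ^ 2 * (b : ℝ) ^ 2| ≤ K * b * Real.sqrt b := by
  have h1ρ : 0 < 1 - ρ := sub_pos.2 hρ1
  obtain ⟨hqm, hqb⟩ := kopCondVar_bounded_measurable κ hh hCh
  have hq0 : ∀ z, 0 ≤ (kop κ (fun y => h y ^ 2) z - (kop κ h z) ^ 2) := kopCondVar_nonneg κ hh hCh
  set m : ℝ := ∫ y, (kop κ (fun y => h y ^ 2) y - (kop κ h y) ^ 2) ∂π with hm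
  set K₀ : ℝ := (4 * Ch ^ 2 * (2 * Ch ^ 2 * A / (1 - ρ))
      + 4 * ((8 * Ch ^ 2 * Ch ^ 2 * A + 32 * Ch ^ 2 * Ch ^ 2 * A ^ 2 / (1 - ρ)) * ρ ^ 0 / (1 - ρ))
      + 25 * Ch ^ 4) with hK₀
  have hK₀0 : 0 ≤ K₀ := by positivity
  refine ⟨K₀ + 40 * Ch ^ 4 + 2 * Ch ^ 4, by positivity, fun μ₀ _ s b => ?_⟩
  set P := (Kernel.trajMeasure (X := fun _ : ℕ => Ω) (μ₀)
        (fun n : ℕ => κ.comap (fun h' : (i : ↥(Finset.Iic n)) → Ω => h' ⟨n, Finset.mem_Iic.2 le_rfl⟩)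
          (measurable_pi_apply _))) with hP
  have hC0 : 0 ≤ Ch := (abs_nonneg _).trans (hCh (Classical.choice
    (nonempty_of_isProbabilityMeasure μ₀)))
  have hm0 : 0 ≤ m := integral_nonneg hq0
  have hmC : m ≤ Ch ^ 2 := by
    have h1 := norm_integral_le_of_norm_le_const (μ := π) (f := fun y => (kop κ (fun y => h y ^ 2) y - (kop κ h y) ^ 2)) (C := Ch ^ 2)
      (Eventually.of_forall fun y => by rw [Real.norm_eq_abs]; exact hqb y)
    rw [Real.norm_eq_abs, probReal_univ, mul_one] at h1
    exact (le_abs_self _).trans h1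
  -- per-`i` integrability and the per-`i` bound
  have hint : ∀ i ∈ Finset.range b, Integrable (fun x : ℕ → Ω => (2 * (∑ r ∈ Finset.range i, (h (x (s + r + 1)) - kop κ h (x (s + r)))) * (h (x (s + i + 1)) - kop κ h (x (s + i))) + ((h (x (s + i + 1)) - kop κ h (x (s + i))) ^ 2 - (kop κ (fun y => h y ^ 2) (x (s + i)) - (kop κ h (x (s + i))) ^ 2))) ^ 2) P := fun i _ =>
    integrable_of_bounded P ((measurable_sqIncr κ hh s i).pow_const 2)
      (C := (8 * Ch ^ 2 * (i + 1)) ^ 2) fun x => by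
        rw [abs_pow]; exact pow_le_pow_left₀ (abs_nonneg _) (abs_sqIncr_le κ hh hCh s i x) 2
  have hper : ∀ i ∈ Finset.range b,
      |∫ x, (2 * (∑ r ∈ Finset.range i, (h (x (s + r + 1)) - kop κ h (x (s + r)))) * (h (x (s + i + 1)) - kop κ h (x (s + i))) + ((h (x (s + i + 1)) - kop κ h (x (s + i))) ^ 2 - (kop κ (fun y => h y ^ 2) (x (s + i)) - (kop κ h (x (s + i))) ^ 2))) ^ 2 ∂P - 4 * m ^ 2 * (i : ℝ)| ≤ K₀ + 40 * Ch ^ 4 * Real.sqrt b := by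
    intro i hi
    have h := abs_chain_sqIncr_sq_integral_sub_le_of_envelope henv hA hρ0 hρ1 hh hCh μ₀ s i
    rw [← hP] at h
    have hsq : Real.sqrt i ≤ Real.sqrt b :=
      Real.sqrt_le_sqrt (by exact_mod_cast (Finset.mem_range.1 hi).le)
    exact h.trans (by nlinarith [mul_nonneg (pow_nonneg hC0 4) (sub_nonneg.2 hsq)])
  rw [integral_finsetSum _ hint]
  -- `Σ ∫η² − 2m²b² = Σ (∫η² − 4m²i) − 2m²b`
  have hrew : ∑ i ∈ Finset.range b, ∫ x, (2 * (∑ r ∈ Finset.range i, (h (x (s + r + 1)) - kop κ h (x (s + r)))) * (h (x (s + i + 1)) - kop κ h (x (s + i))) + ((h (x (s + i + 1)) - kop κ h (x (s + i))) ^ 2 - (kop κ (fun y => h y ^ 2) (x (s + i)) - (kop κ h (x (s + i))) ^ 2))) ^ 2 ∂P - 2 * m ^ 2 * (b : ℝ) ^ 2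
      = ∑ i ∈ Finset.range b, (∫ x, (2 * (∑ r ∈ Finset.range i, (h (x (s + r + 1)) - kop κ h (x (s + r)))) * (h (x (s + i + 1)) - kop κ h (x (s + i))) + ((h (x (s + i + 1)) - kop κ h (x (s + i))) ^ 2 - (kop κ (fun y => h y ^ 2) (x (s + i)) - (kop κ h (x (s + i))) ^ 2))) ^ 2 ∂P - 4 * m ^ 2 * (i : ℝ)) - 2 * m ^ 2 * b := by
    rw [Finset.sum_sub_distrib, sum_range_four_mul_sq_mul m b]; ring
  rw [hrew]
  have hsum : |∑ i ∈ Finset.range b, (∫ x, (2 * (∑ r ∈ Finset.range i, (h (x (s + r + 1)) - kop κ h (x (s + r)))) * (h (x (s + i + 1)) - kop κ h (x (s + i))) + ((h (x (s + i + 1)) - kop κ h (x (s + i))) ^ 2 - (kop κ (fun y => h y ^ 2) (x (s + i)) - (kop κ h (x (s + i))) ^ 2))) ^ 2 ∂P - 4 * m ^ 2 * (i : ℝ))|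
      ≤ b * (K₀ + 40 * Ch ^ 4 * Real.sqrt b) := by
    refine (Finset.abs_sum_le_sum_abs _ _).trans ?_
    calc ∑ i ∈ Finset.range b, |∫ x, (2 * (∑ r ∈ Finset.range i, (h (x (s + r + 1)) - kop κ h (x (s + r)))) * (h (x (s + i + 1)) - kop κ h (x (s + i))) + ((h (x (s + i + 1)) - kop κ h (x (s + i))) ^ 2 - (kop κ (fun y => h y ^ 2) (x (s + i)) - (kop κ h (x (s + i))) ^ 2))) ^ 2 ∂P - 4 * m ^ 2 * (i : ℝ)|
        ≤ ∑ _i ∈ Finset.range b, (K₀ + 40 * Ch ^ 4 * Real.sqrt b) := Finset.sum_le_sum hper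
      _ = b * (K₀ + 40 * Ch ^ 4 * Real.sqrt b) := by
          rw [Finset.sum_const, Finset.card_range, nsmul_eq_mul]
  have hm2 : m ^ 2 ≤ Ch ^ 4 := by
    have := pow_le_pow_left₀ hm0 hmC 2
    linarith [this, show (Ch ^ 2) ^ 2 = Ch ^ 4 by ring]
  rcases Nat.eq_zero_or_pos b with hb | hb
  · subst hb; simp
  have hb1 : (1 : ℝ) ≤ b := by exact_mod_cast hb
  have hsb : 1 ≤ Real.sqrt b := by rw [← Real.sqrt_one]; exact Real.sqrt_le_sqrt hb1
  have hbs : (b : ℝ) ≤ b * Real.sqrt b := le_mul_of_one_le_right (by positivity) hsb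
  calc |∑ i ∈ Finset.range b, (∫ x, (2 * (∑ r ∈ Finset.range i, (h (x (s + r + 1)) - kop κ h (x (s + r)))) * (h (x (s + i + 1)) - kop κ h (x (s + i))) + ((h (x (s + i + 1)) - kop κ h (x (s + i))) ^ 2 - (kop κ (fun y => h y ^ 2) (x (s + i)) - (kop κ h (x (s + i))) ^ 2))) ^ 2 ∂P - 4 * m ^ 2 * (i : ℝ)) - 2 * m ^ 2 * b|
      ≤ |∑ i ∈ Finset.range b, (∫ x, (2 * (∑ r ∈ Finset.range i, (h (x (s + r + 1)) - kop κ h (x (s + r)))) * (h (x (s + i + 1)) - kop κ h (x (s + i))) + ((h (x (s + i + 1)) - kop κ h (x (s + i))) ^ 2 - (kop κ (fun y => h y ^ 2) (x (s + i)) - (kop κ h (x (s + i))) ^ 2))) ^ 2 ∂P - 4 * m ^ 2 * (i : ℝ))| + |2 * m ^ 2 * b| :=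
        abs_sub _ _
    _ ≤ b * (K₀ + 40 * Ch ^ 4 * Real.sqrt b) + 2 * Ch ^ 4 * b := by
        rw [abs_of_nonneg (by positivity : (0 : ℝ) ≤ 2 * m ^ 2 * b)]
        nlinarith [hsum, mul_le_mul_of_nonneg_left hm2 (by positivity : (0 : ℝ) ≤ 2 * b)]
    _ ≤ (K₀ + 40 * Ch ^ 4 + 2 * Ch ^ 4) * b * Real.sqrt b := by
        nlinarith [mul_nonneg hK₀0 (sub_nonneg.2 hbs),
          mul_nonneg (by positivity : (0 : ℝ) ≤ 2 * Ch ^ 4) (sub_nonneg.2 hbs)]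

end Envelope

end Summit.Ventures.LatticeQCDFlow.Scoring

end
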